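import Summits.ResolutionOfSingularities.ResolutionOfSingularities.Theorems.EquisingularLiftEquisingularLiftNatNoseResidueSingularLocusThree
import Summits.ResolutionOfSingularities.ResolutionOfSingularities.Theorems.EquisingularLiftEquisingularLiftNatRegularCase
import HarnessLib

/-!
# [OURS · L1 W4.5(b) · EL♮(3)] NOSE RESIDUE STRUCTURE, brick 8 — the singular curves of `H ⊂ ℙ³_k` are CANONICAL:
# `Z ∈ 𝒞 ↔ Z is closed, irreducible, infinite and ⊆ ι(Sing H)` (no choice in «every singular curve»)

Cell `res-hironaka`, rung L, slot W4.5(b), D-0157 DOOR 1 width seat `res-L1-w45b-nose-w4` (desk WIDTH TABLE D1 row nose-w4; RULING R33 (δ) NOSE WORD v1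
input); crux CHILD EL♮(3) = stmt-ResolutionOfSingularities-20148 (parent EL♮ stmt-…-20038). OURS; NOT a statement of any manuscript; nothing of [Hironaka2017]
is asserted or used; AI kernel work, weaker than expert review. Resolution of singularities in positive characteristic is NOT proved here (dimension 3 is a
theorem in print, Cossart–Piltant 2008/2009). No `sorry`, no new definition, no instance, no notation; standard axioms.
`--kind proof --supports stmt-ResolutionOfSingularities-20148 --as helper`.  Sister files: bricks 1–7 (`…NatNoseResidueUnfold` … `…NatNoseResidueSingularLocusThree`).

* (tree, reused) `withBotENat_le_zero_of_lt_one` (`…NatRegularCase`) — `d < 1 ⇒ d ≤ 0` in `WithBot ℕ∞`.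
* `eq_of_isClosed_infinite_subset_of_dim_le_one` — in a sober Noetherian `T₀` space, a closed INFINITE subset of a closed irreducible set of dimension `≤ 1`
  is all of it (a proper closed subset misses the generic point, so its dimension drops below `1`, so it is finite).
* `mem_of_sUnion_union_of_isIrreducible` — if a closed irreducible infinite `Z` lies in `⋃₀ 𝒞 ∪ P` with `𝒞` a finite family of closed irreducible sets of
  dimension `≤ 1` and `P` a finite set of closed points, then `Z ∈ 𝒞` (irreducible ⊆ finite union of closed sets ⇒ inside one member; not a point; then equal).
* ★ `singularCurves_canonical_three` — for `ι : H ↪ ℙ³_k` a closed immersion of an integral non-regular scheme: the decomposition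
  `ι(Sing H) = ⋃₀ 𝒞 ∪ P` of brick 7 (`singularLocus_curves_and_points_three`) can be taken with `𝒞` CHARACTERISED: for every set `Z`,
  `Z ∈ 𝒞 ↔ (IsClosed Z ∧ IsIrreducible Z ∧ Z.Infinite ∧ Z ⊆ ι(Sing H))`.  So «the singular curves of `H`» is a well-defined FINITE set, independent of any
  choice, and «every singular curve» in bricks 2–6 / NOSE WORD v1 is a finite, canonical quantification.
-/

set_option linter.dupNamespace false

noncomputable section

open CategoryTheory CategoryTheory.Limits AlgebraicGeometry TopologicalSpace Topology IsLocalRing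
open Literature.AlgebraicGeometry.Resolution
open Literature.AlgebraicGeometry.Motives
open AlgebraicGeometry.Scheme.IdealSheafData
open Summit.ResolutionOfSingularities.ResolutionOfSingularities.Cruxes.EquisingularLift.StrataSplit

namespace Summit.ResolutionOfSingularities.ResolutionOfSingularities.Cruxes.EquisingularLiftNat.Sections

/-! ## §1 Topology: infinite closed subsets of one-dimensional irreducible closed sets -/

/-- **A closed infinite subset of a closed irreducible set of dimension `≤ 1` is all of it** (sober Noetherian `T₀` spaces): otherwise it misses the generic
point, its dimension drops below `1` (`Literature.Topology.topologicalKrullDim_lt_of_forall_exists_specializes`), and a subset of dimension `≤ 0` is finite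
(`Set.finite_of_topologicalKrullDim_le_zero`). [folklore] -/
theorem eq_of_isClosed_infinite_subset_of_dim_le_one {X : Type*} [TopologicalSpace X] [QuasiSober X] [T0Space X] [NoetherianSpace X]
    {C Z : Set X} (hC : IsClosed C) (hCirr : IsIrreducible C) (hCdim : topologicalKrullDim C ≤ 1)
    (hZ : IsClosed Z) (hZinf : Z.Infinite) (hZC : Z ⊆ C) : Z = C := by
  by_contra hne
  -- the generic point of `C` is not in `Z`
  have hξ := hCirr.isGenericPoint_genericPoint hC
  have hξZ : hCirr.genericPoint ∉ Z := by
    intro hmem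
    apply hne
    refine Set.Subset.antisymm hZC ?_
    have h : closure ({hCirr.genericPoint} : Set X) ⊆ Z := hZ.closure_subset_iff.mpr (Set.singleton_subset_iff.mpr hmem)
    rwa [isGenericPoint_def.mp hξ] at h
  have hlt : topologicalKrullDim Z < ((1 : ℕ) : WithBot ℕ∞) := by
    refine Literature.Topology.topologicalKrullDim_lt_of_forall_exists_specializes hC hZ hZC
      (fun z hz => ⟨hCirr.genericPoint, hξ.mem, hξZ, hξ.specializes (hZC hz)⟩) 1 ?_
    exact lt_of_le_of_lt hCdim (by exact_mod_cast WithBot.coe_lt_coe.mpr (by decide))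
  exact hZinf (Set.finite_of_topologicalKrullDim_le_zero (withBotENat_le_zero_of_lt_one hlt))

/-- **Membership in a finite «curves + points» decomposition is forced**: a closed irreducible infinite `Z ⊆ ⋃₀ 𝒞 ∪ P`, with `𝒞` a finite family of closed
irreducible sets of dimension `≤ 1` and `P` a finite set of closed points, is a MEMBER of `𝒞`. [folklore] -/
theorem mem_of_sUnion_union_of_isIrreducible {X : Type*} [TopologicalSpace X] [QuasiSober X] [T0Space X] [NoetherianSpace X]
    {𝒞 : Set (Set X)} {P : Set X} (h𝒞 : 𝒞.Finite) (hP : P.Finite)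
    (hC : ∀ C ∈ 𝒞, IsClosed C ∧ IsIrreducible C ∧ topologicalKrullDim C ≤ 1) (hPcl : ∀ p ∈ P, IsClosed ({p} : Set X))
    {Z : Set X} (hZ : IsClosed Z) (hZirr : IsIrreducible Z) (hZinf : Z.Infinite) (hZsub : Z ⊆ ⋃₀ 𝒞 ∪ P) : Z ∈ 𝒞 := by
  classical
  -- the finite closed cover: the members of `𝒞` and the singletons of `P`
  let S : Finset (Set X) := h𝒞.toFinset ∪ hP.toFinset.image (fun p => ({p} : Set X))
  have hScl : ∀ z ∈ S, IsClosed z := by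
    intro z hz
    rcases Finset.mem_union.mp hz with hz | hz
    · exact (hC z (h𝒞.mem_toFinset.mp hz)).1
    · obtain ⟨p, hp, rfl⟩ := Finset.mem_image.mp hz
      exact hPcl p (hP.mem_toFinset.mp hp)
  have hZS : Z ⊆ ⋃₀ (S : Set (Set X)) := by
    intro x hx
    rcases hZsub hx with ⟨C, hC𝒞, hxC⟩ | hxP
    · exact ⟨C, by simp [S, hC𝒞], hxC⟩
    · exact ⟨{x}, by simp [S, hxP], Set.mem_singleton x⟩
  obtain ⟨z, hzS, hZz⟩ := (isIrreducible_iff_sUnion_isClosed.mp hZirr) S hScl hZS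
  rcases Finset.mem_union.mp hzS with hz | hz
  · -- `Z ⊆ C ∈ 𝒞`, hence `Z = C`
    have hz𝒞 : z ∈ 𝒞 := h𝒞.mem_toFinset.mp hz
    obtain ⟨hzcl, hzirr, hzdim⟩ := hC z hz𝒞
    rw [eq_of_isClosed_infinite_subset_of_dim_le_one hzcl hzirr hzdim hZ hZinf hZz]
    exact hz𝒞
  · -- `Z ⊆ {p}` is impossible for an infinite `Z`
    obtain ⟨p, -, rfl⟩ := Finset.mem_image.mp hz
    exact absurd ((Set.finite_singleton p).subset hZz) hZinf

/-! ## §2 The singular curves of a residue surface are canonical -/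

/-- **THE SINGULAR CURVES OF `H ⊂ ℙ³_k` ARE CANONICAL.** For a closed immersion `ι : H ↪ ℙ³_k` (`k` a field) of an integral non-regular scheme there are a
finite family `𝒞` and a finite set `P` of closed points with `ι(Sing H) = ⋃₀ 𝒞 ∪ P` (brick 7) such that, for every set `Z`,
`Z ∈ 𝒞 ↔ IsClosed Z ∧ IsIrreducible Z ∧ Z.Infinite ∧ Z ⊆ ι(Sing H)`; every member moreover satisfies `ι(H) ⊄ Z`, `topologicalKrullDim Z = 1` and the
curve clause `dim 𝒪_{Z̃,z} = 1` at closed points.  So «the singular curves of `H`» = the closed irreducible infinite subsets of `ι(Sing H)` form a FINITE set,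
and each is ready-made nose data for bricks 1–6. [folklore] -/
theorem singularCurves_canonical_three (k : Type) [Field k] (H : Scheme.{0}) (ι : H ⟶ (projectiveSpace 3 k).left)
    [IsClosedImmersion ι] [IsIntegral H] (hH : ¬ Literature.AlgebraicGeometry.Resolution.Scheme.IsRegular H) :
    ∃ (𝒞 : Set (Set (projectiveSpace 3 k).left)) (P : Set (projectiveSpace 3 k).left), 𝒞.Finite ∧ P.Finite ∧
      (∀ p ∈ P, IsClosed ({p} : Set (projectiveSpace 3 k).left) ∧ p ∈ ι '' {x : H | ¬ IsRegularLocalRing (H.presheaf.stalk x)}) ∧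
      ι '' {x : H | ¬ IsRegularLocalRing (H.presheaf.stalk x)} = ⋃₀ 𝒞 ∪ P ∧
      (∀ Z : Set (projectiveSpace 3 k).left,
        Z ∈ 𝒞 ↔ (IsClosed Z ∧ IsIrreducible Z ∧ Z.Infinite ∧ Z ⊆ ι '' {x : H | ¬ IsRegularLocalRing (H.presheaf.stalk x)})) ∧
      (∀ Z ∈ 𝒞, ∃ hZ : IsClosed Z, Z ⊆ Set.range ι ∧ ¬ (Set.range ι ⊆ Z) ∧ topologicalKrullDim Z = 1 ∧
        ∀ z : ↥(redSub (projectiveSpace 3 k).left Z hZ), IsClosed ({z} : Set ↥(redSub (projectiveSpace 3 k).left Z hZ)) →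
          ringKrullDim ((redSub (projectiveSpace 3 k).left Z hZ).presheaf.stalk z) = ((1 : ℕ) : WithBot ℕ∞)) := by
  haveI : IsNoetherian (projectiveSpace 3 k).left :=
    (isNoetherian_and_isQuasiExcellent_of_isClosedImmersion_projectiveSpace 3 (𝟙 (projectiveSpace 3 k).left)).1
  obtain ⟨𝒞, P, h𝒞, hP, hC, hPcl, hU⟩ := singularLocus_curves_and_points_three k H ι hH
  refine ⟨𝒞, P, h𝒞, hP, hPcl, hU, fun Z => ⟨fun hZ => ?_, fun ⟨hZc, hZirr, hZinf, hZS⟩ => ?_⟩, fun Z hZ => ?_⟩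
  · obtain ⟨hZc, hZirr, hZinf, hZS, -⟩ := hC Z hZ
    exact ⟨hZc, hZirr, hZinf, hZS⟩
  · refine mem_of_sUnion_union_of_isIrreducible h𝒞 hP (fun C hC𝒞 => ?_) (fun p hp => (hPcl p hp).1) hZc hZirr hZinf (hU ▸ hZS)
    obtain ⟨hCc, hCirr, -, -, -, -, hCdim, -⟩ := hC C hC𝒞
    exact ⟨hCc, hCirr, hCdim.le⟩
  · obtain ⟨hZc, -, -, -, hZr, hZn, hZdim, hcurve⟩ := hC Z hZ
    exact ⟨hZc, hZr, hZn, hZdim, hcurve⟩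

end Summit.ResolutionOfSingularities.ResolutionOfSingularities.Cruxes.EquisingularLiftNat.Sections

end
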